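import Summits.QuantumAdvantage.QuantumAdvantage.Theses.LinnikCubicClassGroups

/-!
# `LinnikCubicClassGroups.RandomSamplesGenerate` (stmt-QuantumAdvantage-11545) — random samples
# escaping every maximal subgroup generate

Item `stmt-QuantumAdvantage-11545` (route `LinnikCubicClassGroups`, support, rank 9), the folklore
union bound over maximal subgroups behind "random elements generate a finite group with high
probability" (Cheung–Mosca 2001 §3; Hallgren 2005 §4): let `G` be a finite group and `s : Ω → G` a
finite sample space such that every maximal subgroup (coatom of the subgroup lattice) `M` is missed
by at least `δ |Ω|` sample points, `0 ≤ δ ≤ 1`. Then among the `|Ω|^T` sequences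
`v : Fin T → Ω` at most `#Sub(G) · (1 - δ)^T · |Ω|^T` have entries `s (v i)` generating a proper
subgroup.

Proof. The subgroup lattice of a finite group is finite, hence coatomic
(`Finite.to_isCoatomic`): if `closure (range (s ∘ v)) ≠ ⊤` it lies below some coatom `M`, and
then every entry `s (v i)` lies in `M`, i.e. `v` lies in the box
`Fintype.piFinset (fun _ => {ω | s ω ∈ M})`, of cardinality `#{ω | s ω ∈ M}^T ≤ ((1 - δ)|Ω|)^T`
(the hypothesis gives `#{ω | s ω ∈ M} = |Ω| - #{ω | s ω ∉ M} ≤ (1 - δ)|Ω|`). A union bound over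
the coatoms (`Finset.card_biUnion_le`), of which there are at most `Nat.card (Subgroup G)`,
finishes. Degenerate cases are covered by the same argument: `G` trivial (no coatoms, no bad
sequence), `T = 0` (the empty sequence generates `⊥`; bound `#coatoms ≤ #Sub(G)`), `δ = 1`
(every box is empty).

References: K. K. H. Cheung, M. Mosca, *Decomposing finite abelian groups*, Quantum Inf. Comput.
1 (2001), §3 [CheungMosca2001]; S. Hallgren, *Fast quantum algorithms for computing the unit
group and class group of a number field*, STOC 2005, §4 [Hallgren2005]. In-tree measure-theoretic
twin: `Literature.Computability.Cryptography.HallgrenClassGroupGeneration`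
(`toOuterMeasure_closure_ne_top_le`).
-/

namespace Summit.QuantumAdvantage.QuantumAdvantage.Theorems.LinnikCubicClassGroups

open Finset

/-- **Box lemma.** In a finite group, a sequence `v : Fin T → Ω` whose samples `s (v i)` generate
a proper subgroup lies, coordinatewise, inside some maximal subgroup: it belongs to the union over
the coatoms `M` of the boxes `Fintype.piFinset (fun _ => {ω | s ω ∈ M})`. -/
theorem filter_closure_ne_top_subset_biUnion {G : Type*} [Group G] [Finite G] {Ω : Type*}
    [Fintype Ω] [DecidableEq Ω] (s : Ω → G) (T : ℕ) (C : Finset (Subgroup G))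
    (hC : ∀ M : Subgroup G, IsCoatom M → M ∈ C)
    [DecidablePred fun v : Fin T → Ω => Subgroup.closure (Set.range (s ∘ v)) ≠ ⊤]
    [∀ M : Subgroup G, DecidablePred fun ω : Ω => s ω ∈ M] :
    (Finset.univ.filter fun v : Fin T → Ω => Subgroup.closure (Set.range (s ∘ v)) ≠ ⊤) ⊆
      C.biUnion fun M => Fintype.piFinset fun _ : Fin T => Finset.univ.filter fun ω : Ω => s ω ∈ M := by
  haveI : Finite (Subgroup G) :=
    Finite.of_injective (fun P : Subgroup G => (P : Set G)) SetLike.coe_injective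
  haveI : IsCoatomic (Subgroup G) := Finite.to_isCoatomic
  intro v hv
  rw [Finset.mem_filter] at hv
  obtain ⟨M, hMco, hle⟩ :=
    (eq_top_or_exists_le_coatom (Subgroup.closure (Set.range (s ∘ v)))).resolve_left hv.2
  rw [Finset.mem_biUnion]
  refine ⟨M, hC M hMco, ?_⟩
  rw [Fintype.mem_piFinset]
  intro i
  simp only [Finset.mem_filter, Finset.mem_univ, true_and]
  exact hle (Subgroup.subset_closure ⟨i, rfl⟩)

/-- **Box size.** If at least `δ |Ω|` sample points fall outside `M`, the box of sequences with all
samples inside `M` has at most `(1 - δ)^T |Ω|^T` elements. -/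
theorem card_piFinset_filter_mem_le {G : Type*} [Group G] {Ω : Type*} [Fintype Ω] [DecidableEq Ω]
    (s : Ω → G) (δ : ℝ) (T : ℕ) (M : Subgroup G) [DecidablePred fun ω : Ω => s ω ∈ M]
    [DecidablePred fun ω : Ω => s ω ∉ M]
    (hM : δ * (Fintype.card Ω : ℝ) ≤ ((Finset.univ.filter fun ω : Ω => s ω ∉ M).card : ℝ)) :
    ((Fintype.piFinset fun _ : Fin T => Finset.univ.filter fun ω : Ω => s ω ∈ M).card : ℝ) ≤
      (1 - δ) ^ T * (Fintype.card Ω : ℝ) ^ T := by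
  rw [Fintype.card_piFinset_const, Nat.cast_pow, ← mul_pow]
  apply pow_le_pow_left₀ (Nat.cast_nonneg _)
  have hsum : ((Finset.univ.filter fun ω : Ω => s ω ∈ M).card : ℝ) +
      ((Finset.univ.filter fun ω : Ω => s ω ∉ M).card : ℝ) = (Fintype.card Ω : ℝ) := by
    have h := Finset.card_filter_add_card_filter_not (s := (Finset.univ : Finset Ω))
      (fun ω : Ω => s ω ∈ M)
    rw [Finset.card_univ] at h
    exact_mod_cast h
  linarith

/-- **`RandomSamplesGenerate` holds** (item `stmt-QuantumAdvantage-11545`, route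
`LinnikCubicClassGroups`): if every maximal subgroup of the finite group `G` is missed by at least
`δ |Ω|` of the sample points `s : Ω → G` (`0 ≤ δ ≤ 1`), then at most
`Nat.card (Subgroup G) · (1 - δ)^T · |Ω|^T` of the sequences `v : Fin T → Ω` have samples
generating a proper subgroup of `G` (union bound over the coatoms of the finite subgroup lattice).
[cite: CheungMosca2001, §3] [cite: Hallgren2005, §4] -/
theorem randomSamplesGenerate_proof :
    Summit.QuantumAdvantage.QuantumAdvantage.Theses.LinnikCubicClassGroups.RandomSamplesGenerate := by
  unfold Summit.QuantumAdvantage.QuantumAdvantage.Theses.LinnikCubicClassGroups.RandomSamplesGenerate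
  intro G _ _ Ω _ s δ T hδ0 hδ1 hM
  classical
  haveI : Finite (Subgroup G) :=
    Finite.of_injective (fun P : Subgroup G => (P : Set G)) SetLike.coe_injective
  letI : Fintype (Subgroup G) := Fintype.ofFinite _
  -- the finset of coatoms (maximal subgroups)
  set C : Finset (Subgroup G) := Finset.univ.filter fun M : Subgroup G => IsCoatom M with hCdef
  have hC : ∀ M : Subgroup G, IsCoatom M → M ∈ C := fun M hMco => by
    simp only [hCdef, Finset.mem_filter, Finset.mem_univ, true_and]
    exact hMco
  have hC' : ∀ M ∈ C, IsCoatom M := fun M hMC => by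
    simpa only [hCdef, Finset.mem_filter, Finset.mem_univ, true_and] using hMC
  have hCcard : (C.card : ℝ) ≤ (Nat.card (Subgroup G) : ℝ) := by
    rw [Nat.card_eq_fintype_card]
    exact_mod_cast Finset.card_le_univ C
  have hnonneg : 0 ≤ (1 - δ) ^ T * (Fintype.card Ω : ℝ) ^ T :=
    mul_nonneg (pow_nonneg (by linarith) _) (by positivity)
  calc ((Finset.univ.filter fun v : Fin T → Ω =>
          Subgroup.closure (Set.range (s ∘ v)) ≠ ⊤).card : ℝ)
      ≤ ((C.biUnion fun M => Fintype.piFinset fun _ : Fin T =>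
          Finset.univ.filter fun ω : Ω => s ω ∈ M).card : ℝ) := by
        exact_mod_cast Finset.card_le_card (filter_closure_ne_top_subset_biUnion s T C hC)
    _ ≤ ∑ M ∈ C, ((Fintype.piFinset fun _ : Fin T =>
          Finset.univ.filter fun ω : Ω => s ω ∈ M).card : ℝ) := by
        exact_mod_cast Finset.card_biUnion_le
    _ ≤ ∑ _M ∈ C, (1 - δ) ^ T * (Fintype.card Ω : ℝ) ^ T :=
        Finset.sum_le_sum fun M hMC => card_piFinset_filter_mem_le s δ T M (hM M (hC' M hMC))
    _ = (C.card : ℝ) * ((1 - δ) ^ T * (Fintype.card Ω : ℝ) ^ T) := by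
        rw [Finset.sum_const, nsmul_eq_mul]
    _ ≤ (Nat.card (Subgroup G) : ℝ) * ((1 - δ) ^ T * (Fintype.card Ω : ℝ) ^ T) :=
        mul_le_mul_of_nonneg_right hCcard hnonneg
    _ = (Nat.card (Subgroup G) : ℝ) * (1 - δ) ^ T * (Fintype.card Ω : ℝ) ^ T := by ring

end Summit.QuantumAdvantage.QuantumAdvantage.Theorems.LinnikCubicClassGroups
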